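import Literature.NumberTheory.Automorphic.PairLFunctionPolesGLOneTateProofs
import Literature.NumberTheory.Automorphic.PairLFunctionPolesGLOneDedekindProofs
import Literature.NumberTheory.GaloisRepresentations.HeckeLFunctionNonvanishingLineProofs
import HarnessLib

/-!
# Arthur–Clozel (2.2) on the line `Re s = 1`, `s ≠ 1`, for `GL_1 × GL_1` over any number field

Topic `NumberTheory/Automorphic`; namespace `Literature.NumberTheory.Automorphic`. Proof file
(theorems only: no definition, no named fact, no instance, no `sorry`) under the named fact
`JacquetShalika1981_partialPairL_boundary_of_ne_one` of `PairLFunctionPoles` — Arthur–Clozel,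
*Simple algebras, base change, and the advanced theory of the trace formula*, Ann. of Math.
Stud. 120 (1989), Ch. 3 §2, (2.2), p. 171 of the held copy: for unitary cuspidal `π` on
`GL_n(𝔸_K)`, `σ` on `GL_m(𝔸_K)`, `L^S(s, π ⊗ σ)` "extends continuously to the line `Re s = 1`
with `X` removed. Moreover, it does not vanish there" — at the points `s₀ ≠ 1` of the line, here
for **`n = m = 1` over an arbitrary number field `K`**, granted Hecke's continuation theorem
(the named fact `GaloisRepresentations.heckeLFunction_hasEntireContinuation_of_not_isNormTwist`,
Tate (1950), Thm. 4.4.1); the case `K = ℚ` is unconditional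
(`JacquetShalika1981_partialPairL_boundary_of_ne_one_one_rat`, `PairLFunctionPolesGLOneRatProofs`).

In rank one `L^S(s, π × π') = L^S(s, ψ)` with `ψ = χ_π χ_{π'}` a unitary Hecke character trivial
on `A_G` (`CuspidalAutomorphicRepGL.partialPairL_eq_tprod_heckeCharacter₂`). Two cases:

* `ψ = 1`: `L^S(s, 1) = ζ_K^S(s) = ζ_K(s) ∏_{v ∈ S} (1 - N v^{-s})`
  (`tprod_eulerFactor_one_eq_dedekindZetaCont_mul_prod`, `PairLFunctionPolesGLOneDedekindProofs`),
  and `ζ_K(s₀) ≠ 0` for `Re s₀ = 1`, `s₀ ≠ 1` — Landau (1903), **proved** in the tree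
  (`LFunctions.dedekindZetaCont_ne_zero_of_one_le_re_holds`, `DedekindZetaNonvanishing`), so this
  case is unconditional (`tendsto_tprod_eulerFactor_one_of_ne_one_numberField`);
* `ψ ≠ 1`: `ψ` is not a norm twist (`HeckeCharacter.not_isNormTwist_of_map_posRealIdele`), so
  `L(s, ψ^{±1})` have entire continuations `g`, `g'` (Hecke's theorem, the hypothesis), and
  `g(s₀) ≠ 0` on `Re s₀ = 1` by the tree's theorem
  `HeckeCharacter.continuation_apply_ne_zero_of_re_eq_one` (`HeckeLFunctionNonvanishingLineProofs`:
  Hecke–Landau by Landau's method at `s = 1` and the twist `ψ ‖·‖^{it}`; in print Iwasawa (1964),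
  Prop. 4.4); then `L^S(s, ψ) → g(s₀) ∏_{v ∈ S} (1 - c_v N v^{-s₀}) ≠ 0`
  (`tendsto_partialHeckeL_of_continuousAt`).

Main: `JacquetShalika1981_partialPairL_boundary_of_ne_one_one_of_tate`.

## References

* J. Arthur, L. Clozel, *Simple algebras, base change, and the advanced theory of the trace
  formula*, Ann. of Math. Stud. 120 (1989), Ch. 3 §2, (2.2), p. 171. [ArthurClozelAMS120]
* K. Iwasawa, *Hecke's `L`-functions* (lectures, Princeton, Spring 1964), SpringerBriefs (2019),
  Thm. 3.1 (PDF p. 58), Prop. 4.4 (PDF p. 72). [Iwasawa2019]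
* E. Landau, *Neuer Beweis des Primzahlsatzes und Beweis des Primidealsatzes*, Math. Ann. 56
  (1903), 645–670 (non-vanishing of `ζ_K` on `Re s = 1`). [LandauMathAnn1903]
-/

noncomputable section

open scoped MatrixGroups Topology NNReal
open NumberField IsDedekindDomain MeasureTheory Filter Complex Set

namespace Literature.NumberTheory.Automorphic

open AdelicGroupData GaloisRepresentations

variable {K : Type} [Field K] [NumberField K]

/-! ### The partial Dedekind zeta function at the points `s₀ ≠ 1` of `Re s = 1` -/

/-- **`ζ_K^S(s₀) ≠ 0` on `Re s = 1`, `s₀ ≠ 1`**: the partial Dedekind zeta function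
`ζ_K^S(s) = ∏'_{v ∉ S} (1 - N v^{-s})⁻¹` has the finite non-zero limit
`ζ_K(s₀) ∏_{v ∈ S} (1 - N v^{-s₀})` as `s → s₀`, `Re s > 1`, for every `s₀ ≠ 1` with `Re s₀ ≥ 1`:
`ζ_K = dedekindZetaCont K` is holomorphic off `1` (Hecke) and non-zero on `Re s ≥ 1` (Landau
1903, the tree's `LFunctions.dedekindZetaCont_ne_zero_of_one_le_re_holds`), and
`ζ_K^S = ζ_K · ∏_{v ∈ S} (1 - N v^{-s})` on `Re s > 1`
(`tprod_eulerFactor_one_eq_dedekindZetaCont_mul_prod`). [cite: LandauMathAnn1903] -/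
theorem tendsto_tprod_eulerFactor_one_of_ne_one_numberField {S : Set (HeightOneSpectrum (𝓞 K))}
    (hS : S.Finite) {s₀ : ℂ} (hs₀ : 1 ≤ s₀.re) (hs₁ : s₀ ≠ 1) :
    ∃ c : ℂ, c ≠ 0 ∧ Tendsto (fun s : ℂ =>
      ∏' v : {v : HeightOneSpectrum (𝓞 K) // v ∉ S}, (1 - ((v.1.residueCard : ℂ) ^ (-s)))⁻¹)
      (𝓝[{s : ℂ | 1 < s.re}] s₀) (𝓝 c) := by
  classical
  set E : ℂ → ℂ := fun s => ∏ v ∈ hS.toFinset, (1 - ((v.residueCard : ℂ) ^ (-s))) with hE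
  have hEcont : Continuous E :=
    continuous_finsetProd _ fun v _ => continuous_one_sub_residueCard_cpow_neg v
  have hE0 : E s₀ ≠ 0 := Finset.prod_ne_zero_iff.2 fun v _ =>
    one_sub_residueCard_cpow_neg_ne_zero v (by linarith)
  have hζ0 : LFunctions.dedekindZetaCont K s₀ ≠ 0 :=
    LFunctions.dedekindZetaCont_ne_zero_of_one_le_re_holds K hs₀ hs₁
  have hζc : ContinuousAt (LFunctions.dedekindZetaCont K) s₀ :=
    ((LFunctions.NumberField.isDedekindZetaContinuation_dedekindZetaCont_holds K).differentiableOn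
      |>.differentiableAt (isOpen_compl_singleton.mem_nhds hs₁)).continuousAt
  refine ⟨LFunctions.dedekindZetaCont K s₀ * E s₀, mul_ne_zero hζ0 hE0, ?_⟩
  have hlim := (hζc.tendsto.mul (hEcont.tendsto s₀)).mono_left
    (nhdsWithin_le_nhds (s := {s : ℂ | 1 < s.re}) (a := s₀))
  refine hlim.congr' (eventually_nhdsWithin_of_forall fun s hs => ?_)
  exact (tprod_eulerFactor_one_eq_dedekindZetaCont_mul_prod hS hs).symm

/-! ### The limit of `L^S(s, ψ)` at a point of `Re s = 1` from a continuation of `L(s, ψ)` -/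

open scoped Classical in
/-- **The limit of `L^S(s, ψ)` at `s₀` from a continuation of `L(s, ψ)`** (any `s₀` at which
the continuation `g` is continuous): `ψ` unitary, unramified off the finite
`S`, `g = L(·, ψ)` on `Re s > 1`; then `L^S(s, ψ) → g(s₀) ∏_{v ∈ S} (1 - c_v N v^{-s₀})` as
`s → s₀`, `Re s > 1` (`L^S = g · E` on `Re s > 1`, `heckeLFunction_eq_prod_mul_tprod_compl`). The
case `s₀ = 1` is `tendsto_partialHeckeL_of_continuation` of `PairLFunctionPolesGLOneTateProofs`.
[cite: NeukirchANT1999, Ch. VII §8 (before (8.5))] -/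
theorem tendsto_partialHeckeL_of_continuousAt {ψ : HeckeCharacter K} (hψ : ψ.IsUnitary)
    (T : Finset (HeightOneSpectrum (𝓞 K))) (hur : ∀ v ∉ (T : Set (HeightOneSpectrum (𝓞 K))),
      ψ.IsUnramifiedAt v) {g : ℂ → ℂ} {s₀ : ℂ} (hg : ContinuousAt g s₀)
    (hg_eq : ∀ s : ℂ, 1 < s.re → g s = heckeLFunction ψ s) :
    Tendsto (fun s : ℂ => ∏' v : {v : HeightOneSpectrum (𝓞 K) //
        v ∉ (T : Set (HeightOneSpectrum (𝓞 K)))},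
        (1 - ψ.valueAtUniformizer v.1 * ((Ideal.absNorm v.1.asIdeal : ℕ) : ℂ) ^ (-s))⁻¹)
      (𝓝[{s : ℂ | 1 < s.re}] s₀)
      (𝓝 (g s₀ * ∏ v ∈ T, (1 - (if ψ.IsUnramifiedAt v then ψ.valueAtUniformizer v else 0) *
        ((Ideal.absNorm v.asIdeal : ℕ) : ℂ) ^ (-s₀)))) := by
  have hEc : Continuous fun s : ℂ => ∏ v ∈ T, (1 - (if ψ.IsUnramifiedAt v
      then ψ.valueAtUniformizer v else 0) * ((Ideal.absNorm v.asIdeal : ℕ) : ℂ) ^ (-s)) :=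
    continuous_finset_prod_one_sub_mul_cpow T _
  have hlim := (hg.tendsto.mul (hEc.tendsto s₀)).mono_left
    (nhdsWithin_le_nhds (s := {s : ℂ | 1 < s.re}) (a := s₀))
  refine hlim.congr' ?_
  filter_upwards [self_mem_nhdsWithin] with s hs
  have hs1 : 1 < s.re := hs
  have hE0 : ∏ v ∈ T, (1 - (if ψ.IsUnramifiedAt v then ψ.valueAtUniformizer v else 0) *
      ((Ideal.absNorm v.asIdeal : ℕ) : ℂ) ^ (-s)) ≠ 0 :=
    finset_prod_one_sub_mul_cpow_ne_zero T (norm_ite_valueAtUniformizer_le_one hψ) (by linarith)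
  have hsplit := heckeLFunction_eq_prod_mul_tprod_compl hψ T hur hs1
  rw [Finset.prod_inv_distrib] at hsplit
  show g s * (∏ v ∈ T, (1 - (if ψ.IsUnramifiedAt v then ψ.valueAtUniformizer v else 0) *
      ((Ideal.absNorm v.asIdeal : ℕ) : ℂ) ^ (-s))) = _
  rw [hg_eq s hs1, hsplit, mul_comm, ← mul_assoc, mul_inv_cancel₀ hE0, one_mul]

/-! ### The boundary values of `L^S(s, ψ)`, `ψ ≠ 1` trivial on `A_G`, from Hecke's theorem -/

section Assembly

/-- **Hecke–Landau on `Re s = 1` in the limit form, granted Hecke's continuation theorem**: for a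
unitary Hecke character `ψ ≠ 1` of `K` trivial on `A_G = ℝ_{>0}`, a finite `S` off which `ψ` is
unramified, and `Re s₀ = 1`, `L^S(s, ψ)` has a finite **non-zero** limit as `s → s₀`, `Re s > 1`:
`ψ^{±1}` are not norm twists, so `L(s, ψ^{±1})` have entire continuations (hypothesis `hT`, Tate's
Thm. 4.4.1 = Iwasawa's Thm. 3.1), `g(s₀) ≠ 0`
(`HeckeCharacter.continuation_apply_ne_zero_of_re_eq_one`, Iwasawa's Prop. 4.4), and
`L^S(s, ψ) → g(s₀) E(s₀) ≠ 0` (`tendsto_partialHeckeL_of_continuousAt`).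
[cite: Iwasawa2019, Ch. 4 §4.2 Prop. 4.4] -/
theorem exists_ne_zero_tendsto_partialHeckeL_of_tate_of_re_eq_one
    (hT : ∀ χ : HeckeCharacter K, heckeLFunction_hasEntireContinuation_of_not_isNormTwist χ)
    (ψ : HeckeCharacter K) (hu : ψ.IsUnitary) (hA : ∀ t : ℝ≥0ˣ, ψ (posRealIdele K t) = 1)
    (h1 : ψ ≠ 1) {S : Set (HeightOneSpectrum (𝓞 K))} (hS : S.Finite)
    (hur : ∀ v ∉ S, ψ.IsUnramifiedAt v) {s₀ : ℂ} (hs₀ : s₀.re = 1) :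
    ∃ c : ℂ, c ≠ 0 ∧ Tendsto (fun s : ℂ => ∏' v : {v : HeightOneSpectrum (𝓞 K) // v ∉ S},
      (1 - ψ.valueAtUniformizer v.1 * ((v.1.residueCard : ℂ) ^ (-s)))⁻¹)
      (𝓝[{s : ℂ | 1 < s.re}] s₀) (𝓝 c) := by
  classical
  obtain ⟨T, rfl⟩ : ∃ T : Finset (HeightOneSpectrum (𝓞 K)), (T : Set _) = S :=
    ⟨hS.toFinset, hS.coe_toFinset⟩
  have hnt : ¬ψ.IsNormTwist := HeckeCharacter.not_isNormTwist_of_map_posRealIdele hA h1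
  have hnt' : ¬ψ⁻¹.IsNormTwist := fun h => hnt (HeckeCharacter.IsNormTwist.of_inv h)
  obtain ⟨g, hg, hg_eq⟩ := hT ψ hu hnt
  obtain ⟨g', hg', hg'_eq⟩ := hT ψ⁻¹ hu.inv hnt'
  have hg0 : g s₀ ≠ 0 :=
    HeckeCharacter.continuation_apply_ne_zero_of_re_eq_one hu hg hg_eq hg' hg'_eq hs₀
  have hs₀' : 0 < s₀.re := by rw [hs₀]; exact one_pos
  refine ⟨g s₀ * ∏ v ∈ T, (1 - (if ψ.IsUnramifiedAt v then ψ.valueAtUniformizer v else 0) *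
    ((Ideal.absNorm v.asIdeal : ℕ) : ℂ) ^ (-s₀)),
    mul_ne_zero hg0 (finset_prod_one_sub_mul_cpow_ne_zero T
      (norm_ite_valueAtUniformizer_le_one hu) hs₀'), ?_⟩
  exact tendsto_partialHeckeL_of_continuousAt hu T hur hg.continuous.continuousAt hg_eq

variable {μ μ' : Measure (gl 1 K).automorphicQuotient} [(gl 1 K).IsAutomorphicMeasure μ]
  [(gl 1 K).IsAutomorphicMeasure μ']

/-- `1(ϖ_v) = 1` for the trivial Hecke character (a private copy of
`HeckeCharacter.valueAtUniformizer_one` of `ArtinLFunctionsAbelianProofs`, not imported here; the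
siblings `PairLFunctionPolesGLOneRatProofs`, `PairLFunctionPolesGLOneDedekindProofs` keep their
copies private too). [folklore] -/
private theorem valueAtUniformizer_one_boundary (v : HeightOneSpectrum (𝓞 K)) :
    (1 : HeckeCharacter K).valueAtUniformizer v = 1 := by
  rw [HeckeCharacter.valueAtUniformizer, HeckeCharacter.localComponent_apply,
    HeckeCharacter.one_apply, Units.val_one]

/-- **Arthur–Clozel (2.2) at the points `s₀ ≠ 1` of `Re s = 1`, ranks `n = m = 1`, over any
number field `K`, from Hecke's continuation theorem.** Granted the named fact
`heckeLFunction_hasEntireContinuation_of_not_isNormTwist χ` for the Hecke characters of `K`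
(Tate (1950), Thm. 4.4.1), the named fact `JacquetShalika1981_partialPairL_boundary_of_ne_one`
holds for `n = m = 1` over `K`: for cuspidal `π` (measure `μ`) and `π'` (measure `μ'`) of
`GL_1(𝔸_K)` with honest Satake families off a finite `S`, and `Re s₀ = 1`, `s₀ ≠ 1`,
`L^S(s, π × π') = L^S(s, χ_π χ_{π'})` has a finite non-zero limit as `s → s₀`, `Re s > 1`: for
`χ_π χ_{π'} = 1` this is `ζ_K^S(s₀) ≠ 0` (Landau 1903, proved in the tree;
`tendsto_tprod_eulerFactor_one_of_ne_one_numberField`), otherwise Hecke–Landau on the line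
(`exists_ne_zero_tendsto_partialHeckeL_of_tate_of_re_eq_one`). The case `K = ℚ` is
unconditional (`JacquetShalika1981_partialPairL_boundary_of_ne_one_one_rat`).
[cite: ArthurClozelAMS120, Ch. 3 §2 (2.2)] -/
theorem JacquetShalika1981_partialPairL_boundary_of_ne_one_one_of_tate
    (hT : ∀ χ : HeckeCharacter K, heckeLFunction_hasEntireContinuation_of_not_isNormTwist χ) :
    JacquetShalika1981_partialPairL_boundary_of_ne_one (n := 1) (m := 1) (K := K) (μ := μ)
      (μ' := μ') := by
  intro _ _ P P' S hS α β hα hβ s₀ hs₀ hs₁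
  have hfun : partialPairL S α β = fun s : ℂ => ∏' v : {v : HeightOneSpectrum (𝓞 K) // v ∉ S},
      (1 - (P.heckeCharacter * P'.heckeCharacter).valueAtUniformizer v.1 *
        ((v.1.residueCard : ℂ) ^ (-s)))⁻¹ :=
    funext (CuspidalAutomorphicRepGL.partialPairL_eq_tprod_heckeCharacter₂ hα hβ)
  by_cases hψ : P.heckeCharacter * P'.heckeCharacter = 1
  · obtain ⟨c, hc, hlim⟩ :=
      tendsto_tprod_eulerFactor_one_of_ne_one_numberField (K := K) hS (le_of_eq hs₀.symm) hs₁
    refine ⟨c, hc, ?_⟩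
    rw [hfun, hψ]
    simp only [valueAtUniformizer_one_boundary, one_mul]
    exact hlim
  · obtain ⟨c, hc, hlim⟩ := exists_ne_zero_tendsto_partialHeckeL_of_tate_of_re_eq_one hT _
      (P.isUnitary_heckeCharacter.mul P'.isUnitary_heckeCharacter)
      (fun t => by rw [HeckeCharacter.mul_apply, P.heckeCharacter_posRealIdele,
        P'.heckeCharacter_posRealIdele, one_mul]) hψ hS
      (fun v hv => (hα.isUnramifiedAt_heckeCharacter hv).mul (hβ.isUnramifiedAt_heckeCharacter hv))
      hs₀
    refine ⟨c, hc, ?_⟩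
    rw [hfun]
    exact hlim

end Assembly

end Literature.NumberTheory.Automorphic
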